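import Summits.QuantumFields.YangMills.Theorems.UnitScaleTiltProp7CovariantCurlGaugeComparison
import Summits.QuantumFields.YangMills.Theorems.UnitScaleTiltProp7IMSSumOfSquaresLocalisation
import HarnessLib

/-!
# Route `UnitScaleTilt`, crux K1 «MinimiserStabilityRegPr» (stmt-QuantumFields-19200), EX row `hGF` (curved member), the LOD line (★p1 g24 `LOCATE-L6-ASSEMBLY` §1
# Step I.1, ★★OWNER RULINGS №33 ∕ №34) — **(L6-curl): THE CUTOFF COMMUTATOR OF THE COVARIANT CURL `D¹_{U₀}` AND THE FIRST-ORDER (SQUARES-ROAD) LOCALISATION OF THE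
# HESSIAN TERM `re⟪A, Δ^η(U₀)A⟫`** — `Σ_c re⟪(χ_c•X)~, Δ^η(U₀)(χ_c•X)~⟫ ≤ (1+θ)·re⟪X̃, Δ^η(U₀)X̃⟫ + [(1+θ⁻¹)·4ℓ_f²η⁻² + (2+θ)·1029ε₀]·‖X̃‖²` for every real family with
# `Σ_cχ_c² = 1` and per-step family Lipschitz budget `Σ_c(χ_c(x+e_μ) − χ_c(x))² ≤ ℓ_f²`, on `RegPr F n K ε₀ U₀`

Cell `ym3-torus` (HUMAN RULING D-0037: YM₃ on T³ is ladder rung R3 — NOT d = 4, NOT infinite volume, NOT a mass gap, NOT Clay).  Twin-width seat `ym-ust-19200-w7` (gen 11); offer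
«(L6-curl)» 2026-08-30 00:21Z.  THEOREMS ONLY (0 `def`, 0 `sorry`); `--supports stmt-QuantumFields-19200 --as helper`, count-neutral.  HONEST LABEL (№33 (6)): a supplier row of the
curved γ-row line (LOD localisation), Step I.1 (IMS) for the Hessian summand by the SQUARES road; nothing of (3.49), Thm 3.3∕3.11, `hGF`, `h349`, EX or the crux proved.

WHY.  By ✓`Prop7CovariantCurlGaugeComparison.re_inner_DeltaEta_toL2_eq_curlSq_add`, `re⟪X̃, Δ^η(U₀)X̃⟫ = c₀η⁻²·CURL_{U₀}(X) + c₀η⁻²·P_{U₀}(X)` with `CURL_{U₀}(X) = Σ_{posPlaq}‖(D¹_{U₀}X)(p)‖_F²`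
the SQUARE of the first-order stencil (3.4) and `|c₀η⁻²P_{U₀}(X)| ≤ 1029ε₀‖X̃‖²` (✓`abs_curvPart_le`); so the Hessian's localisation needs neither a banded-kernel reading of `Δ^η` nor second
differences of the cutoffs, only the EXACT commutator `D¹_{U₀}(χ•X)(p_{μν}(x)) − χ(x)·D¹_{U₀}X(p_{μν}(x)) = (χ(x+e_μ) − χ(x))·U₀(x,μ)X_ν(x+e_μ)U₀(x,μ)* − (χ(x+e_ν) − χ(x))·U₀(x,ν)X_μ(x+e_ν)U₀(x,ν)*`
(zeroth order in `X`; `Σ_{posPlaq}‖·‖_F² ≤ 4a²Σ_b‖X_b‖_F²` per cutoff, `≤ 4ℓ_f²Σ_b‖X_b‖_F²` for a family), Peter–Paul (✓`Prop7IMSSumOfSquaresLocalisation.normSq_add_le_weighted`) and `Σ_cχ_c² = 1`;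
in `L²` currency the error is `4ℓ_f²η⁻²`, `= 11520·L^{−2s}` at px17 g8's family ✓`Prop7LODCutoffLetters.exists_sqPartition` (`ℓ_f² = 2880∕(L^sL^{K−n})²`) — K-∕volume-free.

WHAT IS PROVED (ns `…Theorems.Prop7CovariantCurlCutoffCommutator`; member `F`, heights `n K`, weight `c₀`):
§1 `curl_srcMul_sub_apply` (the exact commutator stencil); §2 `sum_posPlaq_adjacent_eq` (counting), `sum_normSq_real_smul`, `normSq_curl_srcMul_comm_plaq_le` (one plaquette),
★★`curlSq_srcMul_comm_le` (one cutoff, `4a²`), ★★`sum_curlSq_srcMul_comm_le` (family, `4ℓ_f²`); §3 `norm_sq_toL2_srcMul`, `sum_norm_sq_toL2_srcMul_eq` (`Σ_c‖(χ_c•X)~‖² = ‖X̃‖²`),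
★★★`sum_re_inner_DeltaEta_srcMul_le` (the displayed row, Finset family of site functions); §4 ★★★`sum_re_inner_DeltaEta_cutoffOps_le` — THE SAME IN THE (L6) ASSEMBLER's DOCKING SHAPE
(w5 g13 00:26Z `hq₁`): abstract cut-off OPERATORS `M j : BondL2K →ₗ BondL2K` over a `Fintype J` with px17 g8's reading ✓`exists_cutoffOps_norm_le` clause
`(toL2)⁻¹(M j f) b = χ_j(b₋) • (toL2)⁻¹ f b` VERBATIM, conclusion `∀ A, Σ_j re⟪M j A, Δ^η(U₀)(M j A)⟫ ≤ (1+θ)·re⟪A, Δ^η(U₀)A⟫ + ρ·‖A‖²`.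
HONEST SCOPE.  Stencil algebra and Frobenius bookkeeping over landed dictionaries; the `(1+θ)` on the main term is intrinsic to the squares road (the banded-kernel edition
✓`Prop7IMSDoubleCommutatorRange` keeps coefficient `1` at the price of the kernel's member reading); no estimate of Bałaban's is asserted beyond the cited tree theorems.

References: T. Bałaban, CMP **99** (1985) 389–434 [Balaban1985BackgroundPropagators] ((3.4) p.391, (3.10)–(3.12) p.392, (3.69) p.404, (3.42)–(3.46) pp.398–399 (localisation));
CMP **98** (1985) 17–51 [Balaban1985Averaging] ((18)–(20) p.21).
-/

set_option autoImplicit false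

noncomputable section

open scoped Matrix.Norms.L2Operator BigOperators Matrix InnerProductSpace ComplexConjugate

namespace Summit.QuantumFields.YangMills.Theorems.Prop7CovariantCurlCutoffCommutator

open Literature.MathematicalPhysics.QuantumFieldTheory.Balaban1983to89
open Literature.MathematicalPhysics.QuantumFieldTheory.Balaban1983to89.T3ContinuumYM3Torus
open Literature.MathematicalPhysics.QuantumFieldTheory.Balaban1983to89.T3PrintedRegularMinimiser (RegPr)
open T3SectALandauChart (formComp bgUnits eta eta_pos)
open B9Eq39Adjoint (curl posPlaq)
open B9Eq310Hermitian (deltaPrimeOp)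
open B10Eq27TorusAxialLog (unitsField toUField)
open B9TorusCalculus (torusT)
open B11Eq103H1Complex (BondL2K)
open Summit.QuantumFields.YangMills.Theorems.Prop7SectET3Transport (periodsT3)
open Summit.QuantumFields.YangMills.Theorems.Prop7SectET3HilbertLetters (W₂ frobEquiv toL2)
open Summit.QuantumFields.YangMills.Theorems.Prop7SectET3WilsonHessian (DeltaEta)
open Summit.QuantumFields.YangMills.Theorems.Prop7RieszTauFrobNorm (norm_sq_frobEquiv_symm)
open Summit.QuantumFields.YangMills.Theorems.Prop7DeltaEtaAlmostPositive (norm_toL2_sq)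
open Summit.QuantumFields.YangMills.Theorems.Prop7LocalDivergenceComparison (sum_normSq_add_le sum_normSq_conj_eq)
open Summit.QuantumFields.YangMills.Theorems.Prop7CovariantCurlGaugeComparison (curl_apply re_inner_DeltaEta_toL2_eq_curlSq_add abs_curvPart_le sum_norm_sq_frobEquiv_symm_eq)
open Summit.QuantumFields.YangMills.Theorems.Prop7IMSSumOfSquaresLocalisation (normSq_add_le_weighted)

/-! ## §1 The exact commutator stencil -/

section Stencil

variable {F : T3Family} {K : ℕ}

/-- **THE CUTOFF COMMUTATOR OF THE COVARIANT CURL (3.4), EXACTLY**: for a real site function `χ` and the source multiplication `(χ•A)_κ(z) = χ(z)·A_κ(z)`,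
`D¹_{U₀}(χ•A)(p_{μν}(x)) − χ(x)·D¹_{U₀}A(p_{μν}(x)) = (χ(x+e_μ) − χ(x))·U₀(x,μ)A_ν(x+e_μ)U₀(x,μ)* − (χ(x+e_ν) − χ(x))·U₀(x,ν)A_μ(x+e_ν)U₀(x,ν)*` — the two untransported letters carry
`χ(x)` and cancel; the two far slots pick up `χ` at the shifted base. [cite: Balaban1985BackgroundPropagators, (3.4) p.391] -/
theorem curl_srcMul_sub_apply (U₀ : GaugeField (F.P K) 0 (Matrix.specialUnitaryGroup (Fin 2) ℂ)) (χ : Site (F.P K) 0 → ℝ)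
    (A : Fin (F.P K).d → Site (F.P K) 0 → Matrix (Fin 2) (Fin 2) ℂ) (μ ν : Fin (F.P K).d) (x : Site (F.P K) 0) :
    curl (torusT (F.P K) 0) (fun κ z => unitsField (toUField U₀) ⟨z, κ⟩) (fun κ z => ((χ z : ℝ) : ℂ) • A κ z) μ ν x
        - ((χ x : ℝ) : ℂ) • curl (torusT (F.P K) 0) (fun κ z => unitsField (toUField U₀) ⟨z, κ⟩) A μ ν x
      = ((χ (x.shift μ) - χ x : ℝ) : ℂ) • ((U₀ ⟨x, μ⟩ : Matrix (Fin 2) (Fin 2) ℂ) * A ν (x.shift μ) * star (U₀ ⟨x, μ⟩ : Matrix (Fin 2) (Fin 2) ℂ))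
        - ((χ (x.shift ν) - χ x : ℝ) : ℂ) • ((U₀ ⟨x, ν⟩ : Matrix (Fin 2) (Fin 2) ℂ) * A μ (x.shift ν) * star (U₀ ⟨x, ν⟩ : Matrix (Fin 2) (Fin 2) ℂ)) := by
  rw [curl_apply, curl_apply]
  simp only [Matrix.mul_smul, Matrix.smul_mul, Complex.ofReal_sub, sub_smul, smul_sub]
  abel

end Stencil

/-! ## §2 The commutator is small in `ℓ²`: one cutoff, and a family -/

section Frobenius

variable {F : T3Family} {K : ℕ}

/-- Counting: every bond value is the adjacent slot of exactly `d − 1 = 2` plaquette edges —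
`Σ_{(x;μ<ν)} (S(x+e_μ,ν) + S(x+e_ν,μ)) = 2·Σ_{(y,ν)} S(y,ν)` for any real `S`. [folklore] -/
theorem sum_posPlaq_adjacent_eq (S : Site (F.P K) 0 → Fin (F.P K).d → ℝ) :
    ∑ q ∈ posPlaq (Site (F.P K) 0) (Fin (F.P K).d), (S (q.1.shift q.2.1) q.2.2 + S (q.1.shift q.2.2) q.2.1)
      = 2 * ∑ b : PBond (F.P K) 0, S b.src b.dir := by
  have hd : (F.P K).d = 3 := rfl
  -- the two halves of the ordered-pair sum
  have hx : ∀ x : Site (F.P K) 0, ∑ μ : Fin (F.P K).d, ∑ ν : Fin (F.P K).d, (if μ < ν then S (x.shift μ) ν + S (x.shift ν) μ else 0)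
      = ∑ μ : Fin (F.P K).d, ∑ ν : Fin (F.P K).d, (if μ ≠ ν then S (x.shift μ) ν else 0) := by
    intro x
    have hA : ∑ μ : Fin (F.P K).d, ∑ ν : Fin (F.P K).d, (if μ < ν then S (x.shift μ) ν + S (x.shift ν) μ else 0)
        = ∑ μ : Fin (F.P K).d, ∑ ν : Fin (F.P K).d, (if μ < ν then S (x.shift μ) ν else 0)
          + ∑ μ : Fin (F.P K).d, ∑ ν : Fin (F.P K).d, (if μ < ν then S (x.shift ν) μ else 0) := by
      rw [← Finset.sum_add_distrib]
      refine Finset.sum_congr rfl fun μ _ => ?_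
      rw [← Finset.sum_add_distrib]
      refine Finset.sum_congr rfl fun ν _ => ?_
      split_ifs <;> simp
    have hB : ∑ μ : Fin (F.P K).d, ∑ ν : Fin (F.P K).d, (if μ < ν then S (x.shift ν) μ else 0)
        = ∑ μ : Fin (F.P K).d, ∑ ν : Fin (F.P K).d, (if ν < μ then S (x.shift μ) ν else 0) := Finset.sum_comm
    rw [hA, hB, ← Finset.sum_add_distrib]
    refine Finset.sum_congr rfl fun μ _ => ?_
    rw [← Finset.sum_add_distrib]
    refine Finset.sum_congr rfl fun ν _ => ?_
    rcases lt_trichotomy μ ν with h | h | h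
    · rw [if_pos h, if_neg (not_lt.mpr h.le), if_pos (ne_of_lt h), add_zero]
    · rw [if_neg (lt_irrefl _ ∘ (h ▸ ·)), if_neg (lt_irrefl _ ∘ (h ▸ ·)), if_neg (fun hne => hne h), add_zero]
    · rw [if_neg (not_lt.mpr h.le), if_pos h, if_pos (ne_of_lt h).symm, zero_add]
  rw [B9Eq39Adjoint.sum_posPlaq (fun (x : Site (F.P K) 0) (μ ν : Fin (F.P K).d) => S (x.shift μ) ν + S (x.shift ν) μ)]
  rw [Finset.sum_congr rfl fun x _ => hx x]
  -- reindex `x ↦ x.shift μ` inside, for each fixed `μ, ν`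
  have hre : ∀ μ ν : Fin (F.P K).d, ∑ x : Site (F.P K) 0, S (x.shift μ) ν = ∑ y : Site (F.P K) 0, S y ν := fun μ ν => Fintype.sum_equiv (B10StarCount.shiftEquiv μ) _ _ fun _ => rfl
  have hcomm : ∑ x : Site (F.P K) 0, ∑ μ : Fin (F.P K).d, ∑ ν : Fin (F.P K).d, (if μ ≠ ν then S (x.shift μ) ν else 0)
      = ∑ μ : Fin (F.P K).d, ∑ ν : Fin (F.P K).d, (if μ ≠ ν then ∑ y : Site (F.P K) 0, S y ν else 0) := by
    rw [Finset.sum_comm]; refine Finset.sum_congr rfl fun μ _ => ?_; rw [Finset.sum_comm]; refine Finset.sum_congr rfl fun ν _ => ?_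
    split_ifs with h
    · exact hre μ ν
    · simp
  rw [hcomm]
  have hbond : ∑ b : PBond (F.P K) 0, S b.src b.dir = ∑ ν : Fin (F.P K).d, ∑ y : Site (F.P K) 0, S y ν := by
    rw [B10StarCount.sum_pbond, Finset.sum_comm]
  rw [hbond, Finset.sum_comm, Finset.mul_sum]
  refine Finset.sum_congr rfl fun ν _ => ?_
  have hcount : ∑ μ : Fin (F.P K).d, (if μ ≠ ν then ∑ y : Site (F.P K) 0, S y ν else 0)
      = ((Finset.univ.filter fun μ : Fin (F.P K).d => μ ≠ ν).card : ℝ) * ∑ y : Site (F.P K) 0, S y ν := by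
    rw [← Finset.sum_filter, Finset.sum_const, nsmul_eq_mul]
  have hcard : ((Finset.univ.filter fun μ : Fin (F.P K).d => μ ≠ ν).card : ℝ) = 2 := by
    have : (Finset.univ.filter fun μ : Fin (F.P K).d => μ ≠ ν).card = 2 := by
      rw [Finset.filter_ne' Finset.univ ν, Finset.card_erase_of_mem (Finset.mem_univ ν), Finset.card_univ, Fintype.card_fin, hd]
    exact_mod_cast this
  rw [hcount, hcard]

/-- `Σ_{jk}|(t•M)_{jk}|² = t²·Σ_{jk}|M_{jk}|²` for real `t`. [folklore] -/
theorem sum_normSq_real_smul (t : ℝ) (M : Matrix (Fin 2) (Fin 2) ℂ) :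
    ∑ j, ∑ k, ‖((t : ℂ) • M) j k‖ ^ 2 = t ^ 2 * ∑ j, ∑ k, ‖M j k‖ ^ 2 := by
  rw [Finset.mul_sum]; refine Finset.sum_congr rfl fun j _ => ?_; rw [Finset.mul_sum]; refine Finset.sum_congr rfl fun k _ => ?_
  rw [Matrix.smul_apply, smul_eq_mul, norm_mul, Complex.norm_real, Real.norm_eq_abs, mul_pow, sq_abs]

/-- The commutator of one plaquette, in Frobenius: `Σ|K(p)|² ≤ 2(χ(x+e_μ)−χ(x))²Σ|X_ν(x+e_μ)|² + 2(χ(x+e_ν)−χ(x))²Σ|X_μ(x+e_ν)|²` (unitary conjugations are Frobenius-isometric).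
[cite: Balaban1985BackgroundPropagators, (3.4) p.391; Balaban1985Averaging, (18) p.21] -/
theorem normSq_curl_srcMul_comm_plaq_le (U₀ : GaugeField (F.P K) 0 (Matrix.specialUnitaryGroup (Fin 2) ℂ)) (χ : Site (F.P K) 0 → ℝ)
    (X : PBond (F.P K) 0 → Matrix (Fin 2) (Fin 2) ℂ) (μ ν : Fin (F.P K).d) (x : Site (F.P K) 0) :
    ‖(frobEquiv.symm (curl (torusT (F.P K) 0) (fun κ z => bgUnits F K U₀ ⟨z, κ⟩) (formComp (fun b => ((χ b.src : ℝ) : ℂ) • X b)) μ ν x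
        - ((χ x : ℝ) : ℂ) • curl (torusT (F.P K) 0) (fun κ z => bgUnits F K U₀ ⟨z, κ⟩) (formComp X) μ ν x) : W₂)‖ ^ 2
      ≤ 2 * ((χ (x.shift μ) - χ x) ^ 2 * ∑ j, ∑ k, ‖X ⟨x.shift μ, ν⟩ j k‖ ^ 2)
        + 2 * ((χ (x.shift ν) - χ x) ^ 2 * ∑ j, ∑ k, ‖X ⟨x.shift ν, μ⟩ j k‖ ^ 2) := by
  rw [norm_sq_frobEquiv_symm]
  have hcs := curl_srcMul_sub_apply U₀ χ (fun κ z => X ⟨z, κ⟩) μ ν x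
  -- `bgUnits = unitsField ∘ toUField`, `formComp Y κ z = Y ⟨z, κ⟩` (both `rfl`)
  change ∑ j, ∑ k, ‖(curl (torusT (F.P K) 0) (fun κ z => unitsField (toUField U₀) ⟨z, κ⟩) (fun κ z => ((χ z : ℝ) : ℂ) • X ⟨z, κ⟩) μ ν x
      - ((χ x : ℝ) : ℂ) • curl (torusT (F.P K) 0) (fun κ z => unitsField (toUField U₀) ⟨z, κ⟩) (fun κ z => X ⟨z, κ⟩) μ ν x) j k‖ ^ 2 ≤ _
  rw [hcs, sub_eq_add_neg, ← neg_smul]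
  calc _ ≤ 2 * ∑ j, ∑ k, ‖(((χ (x.shift μ) - χ x : ℝ) : ℂ) • ((U₀ ⟨x, μ⟩ : Matrix (Fin 2) (Fin 2) ℂ) * X ⟨x.shift μ, ν⟩ * star (U₀ ⟨x, μ⟩ : Matrix (Fin 2) (Fin 2) ℂ))) j k‖ ^ 2
        + 2 * ∑ j, ∑ k, ‖((-((χ (x.shift ν) - χ x : ℝ) : ℂ)) • ((U₀ ⟨x, ν⟩ : Matrix (Fin 2) (Fin 2) ℂ) * X ⟨x.shift ν, μ⟩ * star (U₀ ⟨x, ν⟩ : Matrix (Fin 2) (Fin 2) ℂ))) j k‖ ^ 2 :=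
        sum_normSq_add_le _ _
    _ = 2 * ((χ (x.shift μ) - χ x) ^ 2 * ∑ j, ∑ k, ‖X ⟨x.shift μ, ν⟩ j k‖ ^ 2)
        + 2 * ((χ (x.shift ν) - χ x) ^ 2 * ∑ j, ∑ k, ‖X ⟨x.shift ν, μ⟩ j k‖ ^ 2) := by
        rw [← Complex.ofReal_neg, sum_normSq_real_smul, sum_normSq_real_smul, neg_sq, sum_normSq_conj_eq, sum_normSq_conj_eq]

/-- ★★ **ONE CUTOFF: `Σ_{posPlaq}‖D¹_{U₀}(χ•X) − χ(x)•D¹_{U₀}X‖_F² ≤ 4a²·Σ_b‖X_b‖_F²`** under the per-step row `|χ(x+e_μ) − χ(x)| ≤ a` (`4 = 2·(d−1)`).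
[cite: Balaban1985BackgroundPropagators, (3.4) p.391, (3.42)–(3.46) pp.398–399] -/
theorem curlSq_srcMul_comm_le (U₀ : GaugeField (F.P K) 0 (Matrix.specialUnitaryGroup (Fin 2) ℂ)) (χ : Site (F.P K) 0 → ℝ) (X : PBond (F.P K) 0 → Matrix (Fin 2) (Fin 2) ℂ)
    {a : ℝ} (ha : ∀ (x : Site (F.P K) 0) (μ : Fin (F.P K).d), |χ (x.shift μ) - χ x| ≤ a) :
    ∑ q ∈ posPlaq (Site (F.P K) 0) (Fin (F.P K).d),
        ‖(frobEquiv.symm (curl (torusT (F.P K) 0) (fun κ z => bgUnits F K U₀ ⟨z, κ⟩) (formComp (fun b => ((χ b.src : ℝ) : ℂ) • X b)) q.2.1 q.2.2 q.1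
            - ((χ q.1 : ℝ) : ℂ) • curl (torusT (F.P K) 0) (fun κ z => bgUnits F K U₀ ⟨z, κ⟩) (formComp X) q.2.1 q.2.2 q.1) : W₂)‖ ^ 2
      ≤ 4 * a ^ 2 * ∑ b : PBond (F.P K) 0, ∑ j, ∑ k, ‖X b j k‖ ^ 2 := by
  set S : Site (F.P K) 0 → Fin (F.P K).d → ℝ := fun y ν => ∑ j, ∑ k, ‖X ⟨y, ν⟩ j k‖ ^ 2 with hS
  have hS0 : ∀ y ν, 0 ≤ S y ν := fun y ν => Finset.sum_nonneg fun j _ => Finset.sum_nonneg fun k _ => sq_nonneg _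
  have ha2 : ∀ (x : Site (F.P K) 0) (μ : Fin (F.P K).d), (χ (x.shift μ) - χ x) ^ 2 ≤ a ^ 2 := fun x μ => by
    rw [← sq_abs]; exact pow_le_pow_left₀ (abs_nonneg _) (ha x μ) 2
  calc _ ≤ ∑ q ∈ posPlaq (Site (F.P K) 0) (Fin (F.P K).d), 2 * a ^ 2 * (S (q.1.shift q.2.1) q.2.2 + S (q.1.shift q.2.2) q.2.1) := by
          refine Finset.sum_le_sum fun q _ => (normSq_curl_srcMul_comm_plaq_le U₀ χ X q.2.1 q.2.2 q.1).trans ?_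
          have h1 := mul_le_mul_of_nonneg_right (ha2 q.1 q.2.1) (hS0 (q.1.shift q.2.1) q.2.2)
          have h2 := mul_le_mul_of_nonneg_right (ha2 q.1 q.2.2) (hS0 (q.1.shift q.2.2) q.2.1)
          rw [hS]; dsimp only; nlinarith [h1, h2]
    _ = 2 * a ^ 2 * (2 * ∑ b : PBond (F.P K) 0, S b.src b.dir) := by rw [← Finset.mul_sum, sum_posPlaq_adjacent_eq]
    _ = 4 * a ^ 2 * ∑ b : PBond (F.P K) 0, ∑ j, ∑ k, ‖X b j k‖ ^ 2 := by rw [hS]; ring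

/-- ★★ **A FAMILY OF CUTOFFS: `Σ_cΣ_{posPlaq}‖D¹_{U₀}(χ_c•X) − χ_c(x)•D¹_{U₀}X‖_F² ≤ 4ℓ_f²·Σ_b‖X_b‖_F²`** under the per-step FAMILY budget `Σ_c(χ_c(x+e_μ) − χ_c(x))² ≤ ℓ_f²`
(px17 g8's ✓`Prop7LODCutoffLetters.exists_sqPartition` clause `hfam`). [cite: Balaban1985BackgroundPropagators, (3.4) p.391, (3.42)–(3.46) pp.398–399] -/
theorem sum_curlSq_srcMul_comm_le {ι : Type*} (s : Finset ι) (U₀ : GaugeField (F.P K) 0 (Matrix.specialUnitaryGroup (Fin 2) ℂ)) (χ : ι → Site (F.P K) 0 → ℝ)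
    (X : PBond (F.P K) 0 → Matrix (Fin 2) (Fin 2) ℂ) {ℓf2 : ℝ}
    (hfam : ∀ (x : Site (F.P K) 0) (μ : Fin (F.P K).d), ∑ c ∈ s, (χ c (x.shift μ) - χ c x) ^ 2 ≤ ℓf2) :
    ∑ c ∈ s, ∑ q ∈ posPlaq (Site (F.P K) 0) (Fin (F.P K).d),
        ‖(frobEquiv.symm (curl (torusT (F.P K) 0) (fun κ z => bgUnits F K U₀ ⟨z, κ⟩) (formComp (fun b => ((χ c b.src : ℝ) : ℂ) • X b)) q.2.1 q.2.2 q.1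
            - ((χ c q.1 : ℝ) : ℂ) • curl (torusT (F.P K) 0) (fun κ z => bgUnits F K U₀ ⟨z, κ⟩) (formComp X) q.2.1 q.2.2 q.1) : W₂)‖ ^ 2
      ≤ 4 * ℓf2 * ∑ b : PBond (F.P K) 0, ∑ j, ∑ k, ‖X b j k‖ ^ 2 := by
  set S : Site (F.P K) 0 → Fin (F.P K).d → ℝ := fun y ν => ∑ j, ∑ k, ‖X ⟨y, ν⟩ j k‖ ^ 2 with hS
  have hS0 : ∀ y ν, 0 ≤ S y ν := fun y ν => Finset.sum_nonneg fun j _ => Finset.sum_nonneg fun k _ => sq_nonneg _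
  rw [Finset.sum_comm]
  calc _ ≤ ∑ q ∈ posPlaq (Site (F.P K) 0) (Fin (F.P K).d), 2 * ℓf2 * (S (q.1.shift q.2.1) q.2.2 + S (q.1.shift q.2.2) q.2.1) := by
          refine Finset.sum_le_sum fun q _ => ?_
          calc ∑ c ∈ s, ‖(frobEquiv.symm (curl (torusT (F.P K) 0) (fun κ z => bgUnits F K U₀ ⟨z, κ⟩) (formComp (fun b => ((χ c b.src : ℝ) : ℂ) • X b)) q.2.1 q.2.2 q.1
                  - ((χ c q.1 : ℝ) : ℂ) • curl (torusT (F.P K) 0) (fun κ z => bgUnits F K U₀ ⟨z, κ⟩) (formComp X) q.2.1 q.2.2 q.1) : W₂)‖ ^ 2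
              ≤ ∑ c ∈ s, (2 * ((χ c (q.1.shift q.2.1) - χ c q.1) ^ 2 * S (q.1.shift q.2.1) q.2.2)
                  + 2 * ((χ c (q.1.shift q.2.2) - χ c q.1) ^ 2 * S (q.1.shift q.2.2) q.2.1)) :=
                Finset.sum_le_sum fun c _ => normSq_curl_srcMul_comm_plaq_le U₀ (χ c) X q.2.1 q.2.2 q.1
            _ = 2 * ((∑ c ∈ s, (χ c (q.1.shift q.2.1) - χ c q.1) ^ 2) * S (q.1.shift q.2.1) q.2.2)
                  + 2 * ((∑ c ∈ s, (χ c (q.1.shift q.2.2) - χ c q.1) ^ 2) * S (q.1.shift q.2.2) q.2.1) := by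
                rw [Finset.sum_add_distrib, ← Finset.mul_sum, ← Finset.mul_sum, ← Finset.sum_mul, ← Finset.sum_mul]
            _ ≤ 2 * (ℓf2 * S (q.1.shift q.2.1) q.2.2) + 2 * (ℓf2 * S (q.1.shift q.2.2) q.2.1) := by
                have h1 := mul_le_mul_of_nonneg_right (hfam q.1 q.2.1) (hS0 (q.1.shift q.2.1) q.2.2)
                have h2 := mul_le_mul_of_nonneg_right (hfam q.1 q.2.2) (hS0 (q.1.shift q.2.2) q.2.1)
                linarith
            _ = 2 * ℓf2 * (S (q.1.shift q.2.1) q.2.2 + S (q.1.shift q.2.2) q.2.1) := by ring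
    _ = 2 * ℓf2 * (2 * ∑ b : PBond (F.P K) 0, S b.src b.dir) := by rw [← Finset.mul_sum, sum_posPlaq_adjacent_eq]
    _ = 4 * ℓf2 * ∑ b : PBond (F.P K) 0, ∑ j, ∑ k, ‖X b j k‖ ^ 2 := by rw [hS]; ring

end Frobenius

/-! ## §3 ★★★ The Hessian's Step I.1 row by the squares road -/

section Row

variable (F : T3Family) (n K : ℕ) (c₀ : ℝ) [Fact (0 < c₀)]

/-- `‖(χ•X)~‖² = c₀·Σ_b χ(b₋)²‖X_b‖_F²`. [cite: Balaban1985BackgroundPropagators, (3.11) p.392] -/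
theorem norm_sq_toL2_srcMul (χ : Site (F.P K) 0 → ℝ) (X : PBond (F.P K) 0 → Matrix (Fin 2) (Fin 2) ℂ) :
    ‖toL2 F K c₀ (fun b => ((χ b.src : ℝ) : ℂ) • X b)‖ ^ 2 = c₀ * ∑ b : PBond (F.P K) 0, χ b.src ^ 2 * ∑ j, ∑ k, ‖X b j k‖ ^ 2 := by
  rw [norm_toL2_sq, sum_norm_sq_frobEquiv_symm_eq]
  congr 1
  exact Finset.sum_congr rfl fun b _ => sum_normSq_real_smul (χ b.src) (X b)

/-- **A PARTITION WITH `Σ_cχ_c² = 1` SPLITS THE NORM EXACTLY**: `Σ_c‖(χ_c•X)~‖² = ‖X̃‖²`. [cite: Balaban1985BackgroundPropagators, (3.42)–(3.46) pp.398–399] -/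
theorem sum_norm_sq_toL2_srcMul_eq {ι : Type*} (s : Finset ι) (χ : ι → Site (F.P K) 0 → ℝ) (hsq : ∀ x : Site (F.P K) 0, ∑ c ∈ s, χ c x ^ 2 = 1)
    (X : PBond (F.P K) 0 → Matrix (Fin 2) (Fin 2) ℂ) :
    ∑ c ∈ s, ‖toL2 F K c₀ (fun b => ((χ c b.src : ℝ) : ℂ) • X b)‖ ^ 2 = ‖toL2 F K c₀ X‖ ^ 2 := by
  simp_rw [norm_sq_toL2_srcMul]
  rw [← Finset.mul_sum, Finset.sum_comm, norm_toL2_sq, sum_norm_sq_frobEquiv_symm_eq]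
  congr 1
  refine Finset.sum_congr rfl fun b _ => ?_
  rw [← Finset.sum_mul, hsq, one_mul]

/-- ★★★ **STEP I.1 FOR THE HESSIAN TERM BY THE SQUARES ROAD.**  On `RegPr F n K ε₀ U₀` (`0 ≤ ε₀`), for every finite real family `χ_c` with `Σ_cχ_c(x)² = 1` at every site and the per-step
family budget `Σ_c(χ_c(x+e_μ) − χ_c(x))² ≤ ℓ_f²`, every complex one-form `X` and every `θ > 0`:
`Σ_c re⟪(χ_c•X)~, Δ^η(U₀)(χ_c•X)~⟫ ≤ (1+θ)·re⟪X̃, Δ^η(U₀)X̃⟫ + ((1+θ⁻¹)·(4·η⁻²·ℓ_f²) + (2+θ)·(1029ε₀))·‖X̃‖²` — the curl part by the commutator (§2) and Peter–Paul, the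
curvature part `P_{U₀}` paid twice at `1029ε₀` (once per cutoff summed with `Σχ² = 1`, once globally inside the `(1+θ)` main term).  At px17 g8's family `ℓ_f² = 2880∕(L^sL^{K−n})²`:
`4η⁻²ℓ_f² = 11520·L^{−2s}` — K-∕volume-free. [cite: Balaban1985BackgroundPropagators, (3.4) p.391, (3.10)–(3.12) p.392, (3.42)–(3.46) pp.398–399, (3.69) p.404] -/
theorem sum_re_inner_DeltaEta_srcMul_le {ι : Type*} (s : Finset ι) {ε₀ : ℝ} (hε₀ : 0 ≤ ε₀) (U₀ : GaugeField (F.P K) 0 (Matrix.specialUnitaryGroup (Fin 2) ℂ))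
    (hreg : RegPr F n K ε₀ U₀) (χ : ι → Site (F.P K) 0 → ℝ) (hsq : ∀ x : Site (F.P K) 0, ∑ c ∈ s, χ c x ^ 2 = 1) {ℓf2 : ℝ}
    (hfam : ∀ (x : Site (F.P K) 0) (μ : Fin (F.P K).d), ∑ c ∈ s, (χ c (x.shift μ) - χ c x) ^ 2 ≤ ℓf2)
    (X : PBond (F.P K) 0 → Matrix (Fin 2) (Fin 2) ℂ) {θ : ℝ} (hθ : 0 < θ) :
    ∑ c ∈ s, RCLike.re ⟪toL2 F K c₀ (fun b => ((χ c b.src : ℝ) : ℂ) • X b), DeltaEta F n K c₀ U₀ (toL2 F K c₀ (fun b => ((χ c b.src : ℝ) : ℂ) • X b))⟫_ℂ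
      ≤ (1 + θ) * RCLike.re ⟪toL2 F K c₀ X, DeltaEta F n K c₀ U₀ (toL2 F K c₀ X)⟫_ℂ
        + ((1 + θ⁻¹) * (4 * ((eta F n K)⁻¹) ^ 2 * ℓf2) + (2 + θ) * (1029 * ε₀)) * ‖toL2 F K c₀ X‖ ^ 2 := by
  have hc₀ : 0 < c₀ := Fact.out
  have hη : 0 < eta F n K := eta_pos F n K
  have hk : 0 ≤ c₀ * (eta F n K)⁻¹ ^ 2 := by positivity
  have hθ' : 0 ≤ 1 + θ⁻¹ := by positivity
  have hηη : (eta F n K)⁻¹ ^ 2 * eta F n K ^ 2 = 1 := by rw [← mul_pow, inv_mul_cancel₀ hη.ne', one_pow]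
  -- letters: the curl family of `X` and of `χ_c•X`, the commutators, the curvature parts, the Frobenius mass
  set T : Site (F.P K) 0 × Fin (F.P K).d × Fin (F.P K).d → W₂ := fun q =>
    frobEquiv.symm (curl (torusT (F.P K) 0) (fun κ z => bgUnits F K U₀ ⟨z, κ⟩) (formComp X) q.2.1 q.2.2 q.1) with hT
  set Tc : ι → Site (F.P K) 0 × Fin (F.P K).d × Fin (F.P K).d → W₂ := fun c q =>
    frobEquiv.symm (curl (torusT (F.P K) 0) (fun κ z => bgUnits F K U₀ ⟨z, κ⟩) (formComp (fun b => ((χ c b.src : ℝ) : ℂ) • X b)) q.2.1 q.2.2 q.1) with hTc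
  set Pc : ι → ℝ := fun c => (∑ b : PBond (F.P K) 0, Matrix.trace ((((χ c b.src : ℝ) : ℂ) • X b).conjTranspose
        * deltaPrimeOp (torusT (F.P K) 0) (fun μ x => bgUnits F K U₀ ⟨x, μ⟩) 1 (formComp (fun b => ((χ c b.src : ℝ) : ℂ) • X b)) b.dir b.src)).re with hPc
  set P : ℝ := (∑ b : PBond (F.P K) 0, Matrix.trace ((X b).conjTranspose
        * deltaPrimeOp (torusT (F.P K) 0) (fun μ x => bgUnits F K U₀ ⟨x, μ⟩) 1 (formComp X) b.dir b.src)).re with hP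
  set SX : ℝ := ∑ b : PBond (F.P K) 0, ∑ j, ∑ k, ‖X b j k‖ ^ 2 with hSX
  have hSX0 : 0 ≤ SX := Finset.sum_nonneg fun b _ => Finset.sum_nonneg fun j _ => Finset.sum_nonneg fun k _ => sq_nonneg _
  have hnorm : ‖toL2 F K c₀ X‖ ^ 2 = c₀ * SX := by rw [norm_toL2_sq, sum_norm_sq_frobEquiv_symm_eq]
  -- the dictionary, globally and per cutoff
  have hL : RCLike.re ⟪toL2 F K c₀ X, DeltaEta F n K c₀ U₀ (toL2 F K c₀ X)⟫_ℂ
      = c₀ * (eta F n K)⁻¹ ^ 2 * ((∑ q ∈ posPlaq (Site (F.P K) 0) (Fin (F.P K).d), ‖T q‖ ^ 2) + P) := re_inner_DeltaEta_toL2_eq_curlSq_add U₀ X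
  have hLc : ∀ c, RCLike.re ⟪toL2 F K c₀ (fun b => ((χ c b.src : ℝ) : ℂ) • X b), DeltaEta F n K c₀ U₀ (toL2 F K c₀ (fun b => ((χ c b.src : ℝ) : ℂ) • X b))⟫_ℂ
      = c₀ * (eta F n K)⁻¹ ^ 2 * ((∑ q ∈ posPlaq (Site (F.P K) 0) (Fin (F.P K).d), ‖Tc c q‖ ^ 2) + Pc c) := fun c =>
    re_inner_DeltaEta_toL2_eq_curlSq_add U₀ _
  -- curvature parts: per cutoff and global
  have hPc_le : ∀ c, |Pc c| ≤ 1029 * (ε₀ * eta F n K ^ 2) * ∑ b : PBond (F.P K) 0, χ c b.src ^ 2 * ∑ j, ∑ k, ‖X b j k‖ ^ 2 := by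
    intro c
    have h := abs_curvPart_le (n := n) hε₀ U₀ hreg (fun b => ((χ c b.src : ℝ) : ℂ) • X b)
    rw [sum_norm_sq_frobEquiv_symm_eq] at h
    simp_rw [sum_normSq_real_smul] at h
    exact h
  have hP_le : |P| ≤ 1029 * (ε₀ * eta F n K ^ 2) * SX := by
    have h := abs_curvPart_le (n := n) hε₀ U₀ hreg X
    rwa [sum_norm_sq_frobEquiv_symm_eq] at h
  have hsumχ : ∑ c ∈ s, ∑ b : PBond (F.P K) 0, χ c b.src ^ 2 * ∑ j, ∑ k, ‖X b j k‖ ^ 2 = SX := by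
    rw [Finset.sum_comm]
    refine Finset.sum_congr rfl fun b _ => ?_
    rw [← Finset.sum_mul, hsq, one_mul]
  have hPc_sum : ∑ c ∈ s, Pc c ≤ 1029 * (ε₀ * eta F n K ^ 2) * SX := by
    calc ∑ c ∈ s, Pc c ≤ ∑ c ∈ s, |Pc c| := Finset.sum_le_sum fun c _ => le_abs_self _
      _ ≤ ∑ c ∈ s, 1029 * (ε₀ * eta F n K ^ 2) * ∑ b : PBond (F.P K) 0, χ c b.src ^ 2 * ∑ j, ∑ k, ‖X b j k‖ ^ 2 := Finset.sum_le_sum fun c _ => hPc_le c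
      _ = 1029 * (ε₀ * eta F n K ^ 2) * SX := by rw [← Finset.mul_sum, hsumχ]
  -- the curl family: Peter–Paul per plaquette with `Tc c q = χ_c(x)•T q + K_c q`
  have hcurl : ∑ c ∈ s, ∑ q ∈ posPlaq (Site (F.P K) 0) (Fin (F.P K).d), ‖Tc c q‖ ^ 2
      ≤ (1 + θ) * ∑ q ∈ posPlaq (Site (F.P K) 0) (Fin (F.P K).d), ‖T q‖ ^ 2 + (1 + θ⁻¹) * (4 * ℓf2 * SX) := by
    have hK := sum_curlSq_srcMul_comm_le s U₀ χ X hfam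
    -- per `(c, q)`: `‖Tc‖² ≤ (1+θ)χ_c(x)²‖T‖² + (1+θ⁻¹)‖Tc − χ•T‖²`
    have hpp : ∀ c q, ‖Tc c q‖ ^ 2 ≤ (1 + θ) * (χ c q.1 ^ 2 * ‖T q‖ ^ 2) + (1 + θ⁻¹) * ‖Tc c q - ((χ c q.1 : ℝ) : ℂ) • T q‖ ^ 2 := by
      intro c q
      have h := normSq_add_le_weighted (((χ c q.1 : ℝ) : ℂ) • T q) (Tc c q - ((χ c q.1 : ℝ) : ℂ) • T q) hθ
      rw [add_sub_cancel, norm_smul, Complex.norm_real, Real.norm_eq_abs, mul_pow, sq_abs] at h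
      exact h
    calc ∑ c ∈ s, ∑ q ∈ posPlaq (Site (F.P K) 0) (Fin (F.P K).d), ‖Tc c q‖ ^ 2
        ≤ ∑ c ∈ s, ∑ q ∈ posPlaq (Site (F.P K) 0) (Fin (F.P K).d),
            ((1 + θ) * (χ c q.1 ^ 2 * ‖T q‖ ^ 2) + (1 + θ⁻¹) * ‖Tc c q - ((χ c q.1 : ℝ) : ℂ) • T q‖ ^ 2) :=
          Finset.sum_le_sum fun c _ => Finset.sum_le_sum fun q _ => hpp c q
      _ = (1 + θ) * ∑ q ∈ posPlaq (Site (F.P K) 0) (Fin (F.P K).d), (∑ c ∈ s, χ c q.1 ^ 2) * ‖T q‖ ^ 2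
          + (1 + θ⁻¹) * ∑ c ∈ s, ∑ q ∈ posPlaq (Site (F.P K) 0) (Fin (F.P K).d), ‖Tc c q - ((χ c q.1 : ℝ) : ℂ) • T q‖ ^ 2 := by
          have e2 : ∑ c ∈ s, ∑ q ∈ posPlaq (Site (F.P K) 0) (Fin (F.P K).d), (1 + θ) * (χ c q.1 ^ 2 * ‖T q‖ ^ 2)
              = (1 + θ) * ∑ q ∈ posPlaq (Site (F.P K) 0) (Fin (F.P K).d), (∑ c ∈ s, χ c q.1 ^ 2) * ‖T q‖ ^ 2 := by
            rw [Finset.sum_comm, Finset.mul_sum]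
            refine Finset.sum_congr rfl fun q _ => ?_
            rw [← Finset.mul_sum, Finset.sum_mul]
          have e3 : ∑ c ∈ s, ∑ q ∈ posPlaq (Site (F.P K) 0) (Fin (F.P K).d), (1 + θ⁻¹) * ‖Tc c q - ((χ c q.1 : ℝ) : ℂ) • T q‖ ^ 2
              = (1 + θ⁻¹) * ∑ c ∈ s, ∑ q ∈ posPlaq (Site (F.P K) 0) (Fin (F.P K).d), ‖Tc c q - ((χ c q.1 : ℝ) : ℂ) • T q‖ ^ 2 := by
            rw [Finset.mul_sum]; exact Finset.sum_congr rfl fun c _ => by rw [Finset.mul_sum]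
          simp only [Finset.sum_add_distrib]
          rw [e2, e3]
      _ = (1 + θ) * ∑ q ∈ posPlaq (Site (F.P K) 0) (Fin (F.P K).d), ‖T q‖ ^ 2
          + (1 + θ⁻¹) * ∑ c ∈ s, ∑ q ∈ posPlaq (Site (F.P K) 0) (Fin (F.P K).d), ‖Tc c q - ((χ c q.1 : ℝ) : ℂ) • T q‖ ^ 2 := by
          congr 2
          exact Finset.sum_congr rfl fun q _ => by rw [hsq, one_mul]
      _ ≤ (1 + θ) * ∑ q ∈ posPlaq (Site (F.P K) 0) (Fin (F.P K).d), ‖T q‖ ^ 2 + (1 + θ⁻¹) * (4 * ℓf2 * SX) := by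
          gcongr
          refine le_of_eq_of_le (Finset.sum_congr rfl fun c _ => Finset.sum_congr rfl fun q _ => ?_) hK
          rw [hTc, hT, ← map_smul, ← map_sub]
  -- assemble
  have hT0 : 0 ≤ ∑ q ∈ posPlaq (Site (F.P K) 0) (Fin (F.P K).d), ‖T q‖ ^ 2 := Finset.sum_nonneg fun q _ => sq_nonneg _
  simp_rw [hLc]
  rw [← Finset.mul_sum, Finset.sum_add_distrib, hL, hnorm]
  have h1 : c₀ * (eta F n K)⁻¹ ^ 2 * (∑ c ∈ s, ∑ q ∈ posPlaq (Site (F.P K) 0) (Fin (F.P K).d), ‖Tc c q‖ ^ 2 + ∑ c ∈ s, Pc c)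
      ≤ c₀ * (eta F n K)⁻¹ ^ 2 * (((1 + θ) * ∑ q ∈ posPlaq (Site (F.P K) 0) (Fin (F.P K).d), ‖T q‖ ^ 2 + (1 + θ⁻¹) * (4 * ℓf2 * SX))
          + 1029 * (ε₀ * eta F n K ^ 2) * SX) := mul_le_mul_of_nonneg_left (add_le_add hcurl hPc_sum) hk
  have h2 : -((1 + θ) * (c₀ * (eta F n K)⁻¹ ^ 2 * P)) ≤ (1 + θ) * (1029 * ε₀ * (c₀ * SX)) := by
    have h3 : c₀ * (eta F n K)⁻¹ ^ 2 * |P| ≤ c₀ * (eta F n K)⁻¹ ^ 2 * (1029 * (ε₀ * eta F n K ^ 2) * SX) := mul_le_mul_of_nonneg_left hP_le hk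
    have h4 : c₀ * (eta F n K)⁻¹ ^ 2 * (1029 * (ε₀ * eta F n K ^ 2) * SX) = 1029 * ε₀ * (c₀ * SX) * ((eta F n K)⁻¹ ^ 2 * eta F n K ^ 2) := by ring
    rw [h4, hηη, mul_one] at h3
    have h5 : -(c₀ * (eta F n K)⁻¹ ^ 2 * P) ≤ c₀ * (eta F n K)⁻¹ ^ 2 * |P| := by
      rw [← mul_neg]; exact mul_le_mul_of_nonneg_left (neg_le_abs P) hk
    have h1θ : 0 ≤ 1 + θ := by positivity
    nlinarith [h3, h5, h1θ]
  calc c₀ * (eta F n K)⁻¹ ^ 2 * (∑ c ∈ s, ∑ q ∈ posPlaq (Site (F.P K) 0) (Fin (F.P K).d), ‖Tc c q‖ ^ 2 + ∑ c ∈ s, Pc c)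
      ≤ c₀ * (eta F n K)⁻¹ ^ 2 * (((1 + θ) * ∑ q ∈ posPlaq (Site (F.P K) 0) (Fin (F.P K).d), ‖T q‖ ^ 2 + (1 + θ⁻¹) * (4 * ℓf2 * SX))
          + 1029 * (ε₀ * eta F n K ^ 2) * SX) := h1
    _ = (1 + θ) * (c₀ * (eta F n K)⁻¹ ^ 2 * ((∑ q ∈ posPlaq (Site (F.P K) 0) (Fin (F.P K).d), ‖T q‖ ^ 2) + P))
        + -((1 + θ) * (c₀ * (eta F n K)⁻¹ ^ 2 * P))
        + (1 + θ⁻¹) * (4 * (eta F n K)⁻¹ ^ 2 * ℓf2) * (c₀ * SX) + 1029 * ε₀ * (c₀ * SX) * ((eta F n K)⁻¹ ^ 2 * eta F n K ^ 2) := by ring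
    _ ≤ (1 + θ) * (c₀ * (eta F n K)⁻¹ ^ 2 * ((∑ q ∈ posPlaq (Site (F.P K) 0) (Fin (F.P K).d), ‖T q‖ ^ 2) + P))
        + (1 + θ) * (1029 * ε₀ * (c₀ * SX))
        + (1 + θ⁻¹) * (4 * (eta F n K)⁻¹ ^ 2 * ℓf2) * (c₀ * SX) + 1029 * ε₀ * (c₀ * SX) * ((eta F n K)⁻¹ ^ 2 * eta F n K ^ 2) := by
        gcongr
    _ = _ := by rw [hηη]; ring

end Row

/-! ## §4 ★★★ The docking shape of the (L6) assembly: abstract cut-off operators with px17's readings -/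

section Dock

variable (F : T3Family) (n K : ℕ) (c₀ : ℝ) [Fact (0 < c₀)]

/-- ★★★ **STEP I.1 FOR THE HESSIAN TERM, IN THE (L6) ASSEMBLER's DOCKING SHAPE** (w5 g13 2026-08-30 00:26Z `hq₁`).  For a finite type `J` of cut-off OPERATORS `M j` on the bond `L²`
space that READ as source multiplication by real site functions `χ_j` (px17 g8's ✓`Prop7Lane2CutoffOps.exists_cutoffOps_norm_le` clause, verbatim:
`(toL2)⁻¹(M j f) b = χ_j(b₋) • (toL2)⁻¹ f b`), with `Σ_jχ_j(x)² = 1` and the per-step family budget `Σ_j(χ_j(x+e_μ) − χ_j(x))² ≤ ℓ_f²`, on `RegPr F n K ε₀ U₀`, for every `θ > 0`: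
`∀ A, Σ_j re⟪M j A, Δ^η(U₀)(M j A)⟫ ≤ (1+θ)·re⟪A, Δ^η(U₀)A⟫ + ((1+θ⁻¹)·(4η⁻²ℓ_f²) + (2+θ)·(1029ε₀))·‖A‖²`.
[cite: Balaban1985BackgroundPropagators, (3.4) p.391, (3.10)–(3.12) p.392, (3.42)–(3.46) pp.398–399, (3.69) p.404] -/
theorem sum_re_inner_DeltaEta_cutoffOps_le {J : Type*} [Fintype J] {ε₀ : ℝ} (hε₀ : 0 ≤ ε₀) (U₀ : GaugeField (F.P K) 0 (Matrix.specialUnitaryGroup (Fin 2) ℂ))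
    (hreg : RegPr F n K ε₀ U₀) (M : J → (BondL2K ℂ 3 (periodsT3 F K) c₀ W₂ →ₗ[ℂ] BondL2K ℂ 3 (periodsT3 F K) c₀ W₂)) (χ : J → Site (F.P K) 0 → ℝ)
    (hM : ∀ (j : J) (f : BondL2K ℂ 3 (periodsT3 F K) c₀ W₂) (b : PBond (F.P K) 0), (toL2 F K c₀).symm (M j f) b = χ j b.src • (toL2 F K c₀).symm f b)
    (hsq : ∀ x : Site (F.P K) 0, ∑ j, χ j x ^ 2 = 1) {ℓf2 : ℝ}
    (hfam : ∀ (x : Site (F.P K) 0) (μ : Fin (F.P K).d), ∑ j, (χ j (x.shift μ) - χ j x) ^ 2 ≤ ℓf2) {θ : ℝ} (hθ : 0 < θ) :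
    ∀ A : BondL2K ℂ 3 (periodsT3 F K) c₀ W₂,
      ∑ j, RCLike.re ⟪M j A, DeltaEta F n K c₀ U₀ (M j A)⟫_ℂ
        ≤ (1 + θ) * RCLike.re ⟪A, DeltaEta F n K c₀ U₀ A⟫_ℂ
          + ((1 + θ⁻¹) * (4 * ((eta F n K)⁻¹) ^ 2 * ℓf2) + (2 + θ) * (1029 * ε₀)) * ‖A‖ ^ 2 := by
  intro A
  obtain ⟨X, rfl⟩ := (toL2 F K c₀).surjective A
  -- each `M j (toL2 X)` is the source multiple `toL2 (χ_j•X)`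
  have hMX : ∀ j, M j (toL2 F K c₀ X) = toL2 F K c₀ (fun b => ((χ j b.src : ℝ) : ℂ) • X b) := by
    intro j
    rw [← LinearEquiv.symm_apply_eq]
    funext b
    rw [hM, LinearEquiv.symm_apply_apply, RCLike.real_smul_eq_coe_smul (K := ℂ)]
    rfl
  simp_rw [hMX]
  exact sum_re_inner_DeltaEta_srcMul_le F n K c₀ Finset.univ hε₀ U₀ hreg χ hsq hfam X hθ

end Dock

end Summit.QuantumFields.YangMills.Theorems.Prop7CovariantCurlCutoffCommutator

end
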